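import Summits.AtomisticToContinuum.BoseEinsteinCondensation.Theses.BECConjugateDomination
import Literature.MathematicalPhysics.QuantumManyBody.WeightedCorrector
import Mathlib.Analysis.InnerProductSpace.Laplacian
import Mathlib.Analysis.Calculus.ParametricIntegral
import HarnessLib

/-!
# Route `BECConjugateDomination`, crux `PuffFloor`, line `coupling-slope-pocket` — stub S7c:
# the smeared pair density is `C²` and its Laplacian falls on the kernel

Support file for the crux `Theses.BECConjugateDomination.PuffFloor`
(stmt-AtomisticToContinuum-11785). For a periodic trial state `Ψ` of `n + 2` particles on the
torus of side `L` and a `C²` kernel `k : ℝ³ → ℝ` with `k`, `Dk`, `D²k` bounded by `B`, the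
**smeared pair density**
`G_k(y) = ∫_{[0,L)^{3(n+2)}} k(x₀ − x₁ − y) |Ψ(X)|² dX`
is `C²` on `ℝ³` and `ΔG_k(y) = ∫ (Δk)(x₀ − x₁ − y) |Ψ(X)|² dX`
(`stub_smearedPairDensityLaplacian`). Pure real analysis: differentiation under the integral
sign twice (Mathlib `hasFDerivAt_integral_of_dominated_of_fderiv_le`), continuity of the second
derivative by dominated convergence (`continuous_of_dominated`), and
`Δ = ∑ᵢ D²(·)(eᵢ, eᵢ)` (`InnerProductSpace.laplacian_eq_iteratedFDeriv_orthonormalBasis`). The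
helpers in `PuffFloorSmearedPairDensity` are stated for a general weight `w` that is continuous
and integrable for a measure `μ` on a second-countable space and a continuous "pair separation"
map `c` into `ℝ³`; all dominations are by constants times `‖w‖`. All [folklore].
-/

noncomputable section

namespace Summit.AtomisticToContinuum.BoseEinsteinCondensation.Theorems

open MeasureTheory Filter
open scoped ENNReal NNReal BigOperators Laplacian ContDiff
open Literature.MathematicalPhysics.QuantumManyBody.BoseGas

namespace PuffFloorSmearedPairDensity

variable {α : Type*} [TopologicalSpace α] [MeasurableSpace α] [OpensMeasurableSpace α]
  [SecondCountableTopology α] {μ : Measure α}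
variable {E' : Type*} [NormedAddCommGroup E'] [NormedSpace ℝ E']

/-- Chain rule for the reflection-translation `y ↦ φ (a - y)`:
`D(φ(a − ·))(y) = −Dφ(a − y)`. [folklore] -/
theorem hasFDerivAt_comp_const_sub {φ : Space → E'} (hφ : Differentiable ℝ φ) (a y : Space) :
    HasFDerivAt (fun y' : Space => φ (a - y')) (-(fderiv ℝ φ (a - y))) y := by
  have h : HasFDerivAt (fun y' : Space => φ (a - y'))
      ((fderiv ℝ φ (a - y)).comp (-(ContinuousLinearMap.id ℝ Space))) y :=
    ((hφ (a - y)).hasFDerivAt).comp y ((hasFDerivAt_id y).const_sub a)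
  rw [ContinuousLinearMap.comp_neg, ContinuousLinearMap.comp_id] at h
  exact h

/-- `D(r • φ(a − ·))(y) = −(r • Dφ(a − y))`. [folklore] -/
theorem hasFDerivAt_smul_comp_const_sub {φ : Space → E'} (hφ : Differentiable ℝ φ) (r : ℝ)
    (a y : Space) :
    HasFDerivAt (fun y' : Space => r • φ (a - y')) (-(r • fderiv ℝ φ (a - y))) y := by
  have h := (hasFDerivAt_comp_const_sub hφ a y).fun_const_smul r
  rw [smul_neg] at h
  exact h

/-- The weighted kernel `X ↦ w(X) • φ(c(X) − y)` is integrable for a bounded continuous `φ` and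
a continuous integrable weight. [folklore] -/
theorem integrable_weight_smul {w : α → ℝ} (hw : Continuous w) (hwi : Integrable w μ)
    {c : α → Space} (hc : Continuous c) {φ : Space → E'} (hφ : Continuous φ) {B : ℝ}
    (hB : ∀ z, ‖φ z‖ ≤ B) (y : Space) :
    Integrable (fun X => w X • φ (c X - y)) μ := by
  refine Integrable.mono' (hwi.norm.mul_const B)
    (hw.smul (hφ.comp (hc.sub continuous_const))).aestronglyMeasurable
    (Eventually.of_forall fun X => ?_)
  rw [norm_smul]
  exact mul_le_mul_of_nonneg_left (hB _) (norm_nonneg _)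

/-- The smeared quantity `y ↦ ∫ w(X) • φ(c(X) − y) dμ` is continuous for a bounded continuous
`φ` (dominated convergence). [folklore] -/
theorem continuous_integral_weight_smul {w : α → ℝ} (hw : Continuous w) (hwi : Integrable w μ)
    {c : α → Space} (hc : Continuous c) {φ : Space → E'} (hφ : Continuous φ) {B : ℝ}
    (hB : ∀ z, ‖φ z‖ ≤ B) :
    Continuous fun y : Space => ∫ X, w X • φ (c X - y) ∂μ := by
  refine continuous_of_dominated (bound := fun X => ‖w X‖ * B)
    (fun y => (hw.smul (hφ.comp (hc.sub continuous_const))).aestronglyMeasurable)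
    (fun y => Eventually.of_forall fun X => ?_) (hwi.norm.mul_const B)
    (Eventually.of_forall fun X => ?_)
  · rw [norm_smul]
    exact mul_le_mul_of_nonneg_left (hB _) (norm_nonneg _)
  · exact continuous_const.smul (hφ.comp (continuous_const.sub continuous_id))

/-- **Differentiation under the integral sign** for the smeared quantity: for a `C¹` kernel
`φ` with `φ`, `Dφ` bounded, `D(∫ w • φ(c − ·))(y) = −∫ w(X) • Dφ(c(X) − y) dμ`. [folklore] -/
theorem hasFDerivAt_integral_weight_smul {w : α → ℝ} (hw : Continuous w) (hwi : Integrable w μ)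
    {c : α → Space} (hc : Continuous c) {φ : Space → E'} (hφ : ContDiff ℝ 1 φ) {B₀ B₁ : ℝ}
    (hB₀ : ∀ z, ‖φ z‖ ≤ B₀) (hB₁ : ∀ z, ‖fderiv ℝ φ z‖ ≤ B₁) (y : Space) :
    HasFDerivAt (fun y' : Space => ∫ X, w X • φ (c X - y') ∂μ)
      (-(∫ X, w X • fderiv ℝ φ (c X - y) ∂μ)) y := by
  have hφc : Continuous φ := hφ.continuous
  have hφd : Differentiable ℝ φ := hφ.differentiable one_ne_zero
  have hφ'c : Continuous (fderiv ℝ φ) := hφ.continuous_fderiv one_ne_zero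
  have h : HasFDerivAt (fun y' : Space => ∫ X, w X • φ (c X - y') ∂μ)
      (∫ X, -(w X • fderiv ℝ φ (c X - y)) ∂μ) y :=
    hasFDerivAt_integral_of_dominated_of_fderiv_le (𝕜 := ℝ) (μ := μ)
      (F := fun (y' : Space) (X : α) => w X • φ (c X - y'))
      (F' := fun (y' : Space) (X : α) => -(w X • fderiv ℝ φ (c X - y'))) (x₀ := y)
      (bound := fun X => ‖w X‖ * B₁) (s := Set.univ) Filter.univ_mem
      (Eventually.of_forall fun _ =>
        (hw.smul (hφc.comp (hc.sub continuous_const))).aestronglyMeasurable)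
      (integrable_weight_smul hw hwi hc hφc hB₀ y)
      ((hw.smul (hφ'c.comp (hc.sub continuous_const))).neg.aestronglyMeasurable)
      (Eventually.of_forall fun X y' _ => by
        rw [norm_neg, norm_smul]
        exact mul_le_mul_of_nonneg_left (hB₁ _) (norm_nonneg _))
      (hwi.norm.mul_const B₁)
      (Eventually.of_forall fun X y' _ => hasFDerivAt_smul_comp_const_sub hφd (w X) (c X) y')
  rw [integral_neg] at h
  exact h

/-- `‖D(Dk)(z)‖ = ‖D²k(z)‖`. [folklore] -/
theorem norm_fderiv_fderiv_le {k : Space → ℝ} {B : ℝ} (hB : ∀ z, ‖iteratedFDeriv ℝ 2 k z‖ ≤ B)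
    (z : Space) : ‖fderiv ℝ (fderiv ℝ k) z‖ ≤ B := by
  rw [← norm_iteratedFDeriv_one (𝕜 := ℝ) (fderiv ℝ k), norm_iteratedFDeriv_fderiv]
  exact hB z

/-- **The smeared quantity is `C²` and its Laplacian falls on the kernel.** For a `C²` kernel
`k : ℝ³ → ℝ` with `k`, `Dk`, `D²k` bounded, a continuous integrable weight `w` and a continuous
`c`, the function `G(y) = ∫ w(X) • k(c(X) − y) dμ` is `C²` on `ℝ³` and
`ΔG(y) = ∫ w(X) • (Δk)(c(X) − y) dμ`. [folklore] -/
theorem contDiff_two_integral_weight_smul {w : α → ℝ} (hw : Continuous w) (hwi : Integrable w μ)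
    {c : α → Space} (hc : Continuous c) {k : Space → ℝ} (hk : ContDiff ℝ 2 k) {B₀ B₁ B₂ : ℝ}
    (hB₀ : ∀ z, ‖k z‖ ≤ B₀) (hB₁ : ∀ z, ‖fderiv ℝ k z‖ ≤ B₁)
    (hB₂ : ∀ z, ‖iteratedFDeriv ℝ 2 k z‖ ≤ B₂) :
    ContDiff ℝ 2 (fun y : Space => ∫ X, w X • k (c X - y) ∂μ) ∧
      ∀ y : Space, (Δ (fun y' : Space => ∫ X, w X • k (c X - y') ∂μ)) y =
        ∫ X, w X • (Δ k) (c X - y) ∂μ := by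
  have hk1 : ContDiff ℝ 1 k := hk.of_le one_le_two
  have hk₁ : ContDiff ℝ 1 (fderiv ℝ k) := hk.fderiv_right (m := 1) le_rfl
  have hk₂c : Continuous (fderiv ℝ (fderiv ℝ k)) := hk₁.continuous_fderiv one_ne_zero
  have hB₂' : ∀ z, ‖fderiv ℝ (fderiv ℝ k) z‖ ≤ B₂ := norm_fderiv_fderiv_le hB₂
  set G : Space → ℝ := fun y => ∫ X, w X • k (c X - y) ∂μ with hG_def
  set G₁ : Space → (Space →L[ℝ] ℝ) := fun y => ∫ X, w X • fderiv ℝ k (c X - y) ∂μ with hG₁_def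
  set G₂ : Space → (Space →L[ℝ] Space →L[ℝ] ℝ) :=
    fun y => ∫ X, w X • fderiv ℝ (fderiv ℝ k) (c X - y) ∂μ with hG₂_def
  have hG : ∀ y, HasFDerivAt G (-G₁ y) y := fun y =>
    hasFDerivAt_integral_weight_smul hw hwi hc hk1 hB₀ hB₁ y
  have hG₁ : ∀ y, HasFDerivAt G₁ (-G₂ y) y := fun y =>
    hasFDerivAt_integral_weight_smul hw hwi hc hk₁ hB₁ hB₂' y
  have hG₂ : Continuous G₂ :=
    continuous_integral_weight_smul (φ := fderiv ℝ (fderiv ℝ k)) hw hwi hc hk₂c hB₂'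
  have hnegG₁ : ∀ y, HasFDerivAt (fun y' => -G₁ y') (G₂ y) y := fun y => by
    have h := (hG₁ y).fun_neg
    rw [neg_neg] at h
    exact h
  have hCD : ContDiff ℝ 2 G := by
    have h2 : ((1 : ℕ) : ℕ∞ω) + 1 = 2 := by norm_num
    rw [← h2, contDiff_succ_iff_hasFDerivAt]
    refine ⟨fun y => -G₁ y, ?_, hG⟩
    rw [Nat.cast_one, contDiff_one_iff_hasFDerivAt]
    exact ⟨G₂, hG₂, hnegG₁⟩
  refine ⟨hCD, fun y => ?_⟩
  -- the Laplacian: `ΔG(y) = ∑ᵢ G₂(y)(eᵢ, eᵢ) = ∫ w ∑ᵢ D²k(c − y)(eᵢ, eᵢ) = ∫ w (Δk)(c − y)`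
  have hfd : fderiv ℝ G = fun y' => -G₁ y' := funext fun y' => (hG y').fderiv
  have hfd₂ : fderiv ℝ (fderiv ℝ G) y = G₂ y := by
    rw [hfd]
    exact (hnegG₁ y).fderiv
  set b := stdOrthonormalBasis ℝ Space with hb_def
  -- integrability of the second-order integrand (stated through the helper, whose codomain
  -- carries the normed-group topology of `E'`)
  have hint₂ := integrable_weight_smul (φ := fderiv ℝ (fderiv ℝ k)) hw hwi hc hk₂c hB₂' y
  have happ : ∀ v : Space, G₂ y v v = ∫ X, ((w X • fderiv ℝ (fderiv ℝ k) (c X - y)) v) v ∂μ :=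
    fun v => by
      simp only [hG₂_def]
      rw [ContinuousLinearMap.integral_apply hint₂,
        ContinuousLinearMap.integral_apply (hint₂.apply_continuousLinearMap _)]
  have hsum : ∑ i, ∫ X, ((w X • fderiv ℝ (fderiv ℝ k) (c X - y)) (b i)) (b i) ∂μ =
      ∫ X, ∑ i, ((w X • fderiv ℝ (fderiv ℝ k) (c X - y)) (b i)) (b i) ∂μ :=
    (integral_finsetSum _ fun i _ =>
      (hint₂.apply_continuousLinearMap _).apply_continuousLinearMap _).symm
  rw [InnerProductSpace.laplacian_eq_iteratedFDeriv_orthonormalBasis G b]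
  simp only [iteratedFDeriv_two_apply, Matrix.cons_val_zero, Matrix.cons_val_one, hfd₂, happ]
  rw [hsum]
  refine integral_congr_ae (Eventually.of_forall fun X => ?_)
  rw [InnerProductSpace.laplacian_eq_iteratedFDeriv_orthonormalBasis k b]
  simp only [iteratedFDeriv_two_apply, Matrix.cons_val_zero, Matrix.cons_val_one,
    _root_.smul_apply, smul_eq_mul, Finset.mul_sum]

end PuffFloorSmearedPairDensity

/-- **S7c `stub_smearedPairDensityLaplacian`** (differentiation under the integral sign, twice).
For a periodic trial state `Ψ` of `n+2` particles and a `C²` kernel `k : ℝ³ → ℝ` with `k, Dk, D²k`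
bounded by `B`, the smeared pair density
`G_k(y) = ∫_{Λ^{n+2}} k(x₀ − x₁ − y)|Ψ(X)|² dX` is `C²` on `ℝ³` and its Laplacian is obtained by
differentiating the kernel: `ΔG_k(y) = ∫ (Δk)(x₀ − x₁ − y)|Ψ|²` (`Ψ` is `C¹`, hence `|Ψ|²` is
continuous and integrable on the bounded cell; `hasFDerivAt_integral_of_dominated_of_fderiv_le`
twice, continuity of the second derivative by dominated convergence;
`InnerProductSpace.laplacian_eq_iteratedFDeriv_orthonormalBasis`). [folklore] -/
theorem stub_smearedPairDensityLaplacian :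
    ∀ (n : ℕ) (L : ℝ), 0 < L → ∀ (Ψ : PeriodicTrialState (n + 2) L) (k : Space → ℝ) (B : ℝ),
      ContDiff ℝ 2 k → (∀ z, |k z| ≤ B) → (∀ z, ‖fderiv ℝ k z‖ ≤ B) →
      (∀ z, ‖iteratedFDeriv ℝ 2 k z‖ ≤ B) →
      ContDiff ℝ 2 (fun y : Space => ∫ X in cellN (n + 2) L, k (X 0 - X 1 - y) * ‖Ψ.ψ X‖ ^ 2) ∧
      ∀ y : Space,
        (Δ (fun y' : Space => ∫ X in cellN (n + 2) L, k (X 0 - X 1 - y') * ‖Ψ.ψ X‖ ^ 2)) y =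
          ∫ X in cellN (n + 2) L, (Δ k) (X 0 - X 1 - y) * ‖Ψ.ψ X‖ ^ 2 := by
  intro n L _ Ψ k B hk hk0 hk1 hk2
  have hw : Continuous fun X : Config (n + 2) => ‖Ψ.ψ X‖ ^ 2 :=
    (Ψ.contDiff.continuous.norm).pow 2
  have hwi : Integrable (fun X : Config (n + 2) => ‖Ψ.ψ X‖ ^ 2)
      (volume.restrict (cellN (n + 2) L)) :=
    integrableOn_cellN hw L
  have hc : Continuous fun X : Config (n + 2) => X 0 - X 1 :=
    (continuous_apply 0).sub (continuous_apply 1)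
  have hk0' : ∀ z, ‖k z‖ ≤ B := fun z => by
    rw [Real.norm_eq_abs]
    exact hk0 z
  obtain ⟨hCD, hΔ⟩ := PuffFloorSmearedPairDensity.contDiff_two_integral_weight_smul
    (μ := volume.restrict (cellN (n + 2) L)) hw hwi hc hk hk0' hk1 hk2
  have hfun : (fun y : Space => ∫ X in cellN (n + 2) L, k (X 0 - X 1 - y) * ‖Ψ.ψ X‖ ^ 2) =
      fun y : Space => ∫ X in cellN (n + 2) L, ‖Ψ.ψ X‖ ^ 2 • k (X 0 - X 1 - y) := by
    funext y
    refine integral_congr_ae (Eventually.of_forall fun X => ?_)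
    dsimp only
    rw [smul_eq_mul, mul_comm]
  rw [hfun]
  refine ⟨hCD, fun y => ?_⟩
  rw [hΔ y]
  refine integral_congr_ae (Eventually.of_forall fun X => ?_)
  dsimp only
  rw [smul_eq_mul, mul_comm]

end Summit.AtomisticToContinuum.BoseEinsteinCondensation.Theorems

end
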